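import Summits.ResolutionOfSingularities.ResolutionOfSingularities.Theorems.MarkedTransferCampaignW46MohWindowShadeFormalNRStep
import Summits.ResolutionOfSingularities.ResolutionOfSingularities.Theorems.MarkedTransferCampaignW46MohWindowShadeFormalNRAnchor
import Summits.ResolutionOfSingularities.ResolutionOfSingularities.Theorems.MarkedTransferCampaignW46MohWindowShadeDegreeLaw
import Summits.ResolutionOfSingularities.ResolutionOfSingularities.Theorems.MarkedTransferCampaignW46MohWindowShadeFormalInsepWalk
import HarnessLib

/-!
# [OURS · L1 W4.6 rung (iii-2), NON-RATIONAL POINTS, brick 10] One step along a hit thread with anchors over the residue fields of the points: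
# the model walk in `Ω⟦y⟧` and the bookkeeping of the coefficient subfields `Λ_k ⊆ Ω`

Cell `res-hironaka`, LADDER-RESOLUTION rung L (D-0089), slot W4.6 rung (iii); seat res-L1-s46-pv-6 (gen 7). Host route MarkedTransfer,
`--supports stmt-ResolutionOfSingularities-16155 --as helper`; kind proof (no definition). NON-RATIONAL twin of gen 6's `formalInsepAnchor_succ`
(p549978): the anchor at stage `k` of a hit thread lives over SOME perfect field `L` embedded in a fixed algebraically closed `Ω` (its image the
COEFFICIENT SUBFIELD `Λ_k`); the model state is read in `Ω⟦y⟧`. One step: if the thread point is blown up, brick 7 gives the anchor upstairs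
over `L(λ)`, the model takes the Hauser–Wagner step in `Ω⟦y⟧` at the image point `b`, and the new coefficient subfield is generated over `Λ_k`
by the coordinate `b_{c′}`; the DEGREE LAW (`series_degree_mul_shade_step_le`) is recorded in the form «if the shade does not drop at a
translated point then `b_{c′} ∈ Λ_k`» (a stall forces residue degree `1`); and «`b_{c′} ∈ Λ_k ⇒ Λ_{k+1} ⊆ Λ_k`». Off the centre the anchor is
carried verbatim (`exists_formalNRAnchor_offCentre`, gen 5's transport with an arbitrary coefficient field). OURS; NOT a statement of the
manuscript [claim: Hironaka2017, status: under-review] (Def. 2.1 p.5 — scope only), nothing of which is used. AI-written; AI review is weaker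
than expert review. References: The Stacks Project, Tag 0804; H. Hauser, Bull. AMS 47 (2010) §§F–G. [StacksProject] [Hauser2010] [folklore]
-/

noncomputable section

set_option linter.dupNamespace false -- mandated namespace of this single-conjunct summit

open IsLocalRing MvPolynomial

namespace Summit.ResolutionOfSingularities.ResolutionOfSingularities.Theorems

namespace CampaignW46

namespace MohWindowShadeFormalNR

open CategoryTheory AlgebraicGeometry TopologicalSpace
open Literature.AlgebraicGeometry.Resolution
open Literature.AlgebraicGeometry.Resolution.PointBlowup
open Literature.AlgebraicGeometry.Resolution.Hauser2010
open Literature.AlgebraicGeometry.Hironaka2017.S02Preliminaries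
open Literature.AlgebraicGeometry.Hironaka2017.Datum
open Scheme.IdealSheafData
open MohWindowShadePS

/-! ## §1 Off the centre (any coefficient field) -/

section OffCentre

variable {p : ℕ} [hp : Fact p.Prime] {K : Type} [Field K] [CharP K p] {L : Type} [CommRing L]

/-- **Off the centre a formal anchor over any coefficient ring is carried verbatim** (gen 5's `exists_formalAnchor_offCentre`, p531503, with
the coefficient field decoupled from the ground field). [cite: StacksProject, Tag 0804] -/
theorem exists_formalNRAnchor_offCentre {A A' : AmbientDatum p K} {E : IdealExponent A.Z} {D : Closeds A.Z} (π : A'.Z ⟶ A.Z)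
    (hπ : IsBlowup π (vanishingIdeal D)) {ξ' : A'.Z} (hoff : π.base ξ' ∉ (D : Set A.Z))
    (E₀ : AdicCompletion (maximalIdeal (A.Z.presheaf.stalk (π.base ξ'))) (A.Z.presheaf.stalk (π.base ξ')) ≃+*
      MvPowerSeries (Option (Fin 2)) L)
    {f₀ : A.Z.presheaf.stalk (π.base ξ')} (hJ : stalkIdeal E.J (π.base ξ') = Ideal.span {f₀}) (G : MvPowerSeries (Option (Fin 2)) L)
    (hE₀ : E₀ (algebraMap _ _ f₀) = G) :
    ∃ (E' : AdicCompletion (maximalIdeal (A'.Z.presheaf.stalk ξ')) (A'.Z.presheaf.stalk ξ') ≃+* MvPowerSeries (Option (Fin 2)) L)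
      (f' : A'.Z.presheaf.stalk ξ'), stalkIdeal (E.transform π D).J ξ' = Ideal.span {f'} ∧ E' (algebraMap _ _ f') = G := by
  classical
  haveI : IsLocallyNoetherian A'.Z := ambient_isLocallyNoetherian A'
  set ψ := (π.stalkMap ξ').hom with hψ
  have hnot : π.base ξ' ∉ (vanishingIdeal D).support := by
    rw [← SetLike.mem_coe, Scheme.IdealSheafData.coe_support_vanishingIdeal]; exact hoff
  have h1 : stalkIdeal (E.transform π D).J ξ' = (stalkIdeal E.J (π.base ξ')).map ψ := by
    show stalkIdeal (controlledTransform π (vanishingIdeal D) E.J E.b) ξ' = _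
    rw [hπ.stalkIdeal_controlledTransform_of_not_mem E.J E.b hnot, stalkIdeal_comap_eq_map_stalkMap]
  haveI := hπ.isIso_stalkMap_of_not_mem_support hnot
  set eψ : A.Z.presheaf.stalk (π.base ξ') ≃+* A'.Z.presheaf.stalk ξ' := (asIso (π.stalkMap ξ')).commRingCatIsoToRingEquiv with heψ
  have heψ_apply : ∀ r, eψ r = ψ r := fun r => rfl
  have hmax : (maximalIdeal (A.Z.presheaf.stalk (π.base ξ'))).map eψ.toRingHom = maximalIdeal (A'.Z.presheaf.stalk ξ') :=
    IsLocalRing.map_ringEquiv_maximalIdeal eψ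
  set ê := adicCompletionCongr (maximalIdeal (A.Z.presheaf.stalk (π.base ξ'))) (maximalIdeal (A'.Z.presheaf.stalk ξ')) eψ hmax with hê
  refine ⟨ê.symm.trans E₀, ψ f₀, ?_, ?_⟩
  · rw [h1, hJ, Ideal.map_span, Set.image_singleton]
  · rw [RingEquiv.trans_apply, ← hE₀]
    congr 1
    rw [RingEquiv.symm_apply_eq, ← heψ_apply, hê]
    simp only [AdicCompletion.algebraMap_apply, Algebra.algebraMap_self, RingHom.id_apply]
    rw [adicCompletionCongr_of]

end OffCentre

/-! ## §2 One step along a hit thread -/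

section Thread

variable {p : ℕ} [hp : Fact p.Prime] {K : Type} [Field K] [CharP K p]
  {Ω : Type} [Field Ω] [IsAlgClosed Ω] [DecidableEq Ω] [CharP Ω p]

/-- **The window is STRICT at the bottom for a CLEANED series anchor** over any coefficient field of characteristic `p`: `p < ord F`
(gen 4/5's `window_strict_of_cleaned` read on the truncation of `F` below degree `p + 1` in `L⟦z, u₀, u₁⟧`). [cite: Matsumura1987, Thm 14.2] -/
theorem order_gt_of_formalNRAnchor_clean {L : Type} [Field L] [CharP L p] {A : AmbientDatum p K} {E : IdealExponent A.Z}
    (hRg : regimeMohWindowSurfaceInsep (p := p) (K := K) A E) {ξ : A.Z} (hξ : ξ ∈ E.sing)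
    (e : AdicCompletion (maximalIdeal (A.Z.presheaf.stalk ξ)) (A.Z.presheaf.stalk ξ) ≃+* MvPowerSeries (Option (Fin 2)) L)
    {f₀ : A.Z.presheaf.stalk ξ} (hJ : stalkIdeal E.J ξ = Ideal.span {f₀}) {w : MvPowerSeries (Option (Fin 2)) L} (hw : IsUnit w)
    (F : MvPowerSeries (Fin 2) L) (hclean : IsClean p F)
    (hE : e (algebraMap _ _ f₀) = w * (MvPowerSeries.X none ^ p + MvPowerSeries.rename (some : Fin 2 → Option (Fin 2)) F)) :
    (p : ℕ∞) < F.order := by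
  classical
  have hwin := window_of_formalNRAnchor hRg hξ e hJ hw F hE
  refine lt_of_le_of_ne hwin.1 fun hpo => ?_
  have ho : F.order = p := hpo.symm
  obtain ⟨hR, h3, -, hwinpt, hb⟩ := MohWindowShadeAnchorWalk.regime_point hRg hξ
  haveI := hR
  set S := MvPowerSeries (Option (Fin 2)) L
  have hRS : IsRegularLocalRing S := MohWindowShadeFormalAnchor.isRegularLocalRing_S L
  haveI : CharP S p := charP_of_injective_algebraMap (algebraMap L S).injective p
  set I' := (stalkIdeal E.J ξ).map ((e : _ →+* S).comp (algebraMap (A.Z.presheaf.stalk ξ)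
    (AdicCompletion (maximalIdeal (A.Z.presheaf.stalk ξ)) (A.Z.presheaf.stalk ξ)))) with hI'
  have hI'eq : I' = Ideal.span {MvPowerSeries.X none ^ p + MvPowerSeries.rename (some : Fin 2 → Option (Fin 2)) F} :=
    MohWindowShadeFormalAnchor.map_span_eq_of_unit_mul e hJ hw hE
  have hwin' : MohWindowSurfaceAt p S I' := MohWindowShadeFormalAnchor.mohWindowSurfaceAt_map e hwinpt
  obtain ⟨hR', h3', x', y', z', hxyz', d, a, hpd, hd2, hunit, hI⟩ := hwin'.coeffAt
  have hG := MohWindowSurfaceResidualOrder.isGreatest_window_exponent p hR' h3' hxyz' hpd hd2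
    (MohWindowSurface.coeffForm_mem_span_pow x' y' d a) (MohWindowSurface.coeffForm_not_mem_pow_succ hR' h3' hxyz' hunit) (z := z')
  obtain ⟨v, hv, hle⟩ := hG.1
  rw [← hI, hI'eq] at hle
  -- truncate `F` below degree `p + 1`
  set FT := truncTot (p + 1) F with hFT
  have hA : Agree (p + 1) ((⟨F, 0⟩ : Series (Fin 2) L).trunc (p + 1)) ⟨F, 0⟩ := agree_trunc _ _
  have hoT : ordZero FT = p := hA.ordZero_eq ho (Nat.lt_succ_self p)
  have hcleanT : deletePthPowers p FT = FT := hclean.deletePthPowers_truncTot _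
  have hFTeq : (FT : MvPowerSeries (Fin 2) L) = ↑(MvPowerSeries.truncTotal (p + 1) F) := by
    ext d
    rw [MvPolynomial.coeff_coe, MvPolynomial.coeff_coe, hFT, coeff_truncTot, MvPowerSeries.coeff_truncTotal_eq_ite]
  have htail : MvPowerSeries.rename (some : Fin 2 → Option (Fin 2)) F - MvPowerSeries.rename (some : Fin 2 → Option (Fin 2)) (FT : MvPowerSeries (Fin 2) L) ∈
      maximalIdeal S ^ (p + 1) := by
    rw [← map_sub, hFTeq]
    exact AtomGerm.rename_some_mem_maximalIdeal_pow (Literature.RingTheory.MvPowerSeries.Jets.sub_coe_truncTotal_mem_maximalIdeal_pow (p + 1) F)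
  have hle' : Ideal.span {MvPowerSeries.X none ^ p + eval₂ MvPowerSeries.C
      (fun l : Fin 2 => if l = (0 : Fin 2) then (MvPowerSeries.X (some (0 : Fin 2)) : S) else MvPowerSeries.X (some 1)) FT} ≤
      Ideal.span {v ^ p} ⊔ maximalIdeal S ^ (p + 1) := by
    rw [MohWindowShadeFormalAnchor.eval₂_frame_eq_rename, Ideal.span_singleton_le_iff_mem]
    have h1 : MvPowerSeries.X none ^ p + MvPowerSeries.rename (some : Fin 2 → Option (Fin 2)) F ∈ Ideal.span {v ^ p} ⊔ maximalIdeal S ^ (p + 1) :=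
      (hle.trans (sup_le_sup_left (Ideal.pow_le_pow_right hpd) _)) (Ideal.mem_span_singleton_self _)
    have e1 : MvPowerSeries.X none ^ p + MvPowerSeries.rename (some : Fin 2 → Option (Fin 2)) (FT : MvPowerSeries (Fin 2) L) =
        (MvPowerSeries.X none ^ p + MvPowerSeries.rename (some : Fin 2 → Option (Fin 2)) F) -
          (MvPowerSeries.rename (some : Fin 2 → Option (Fin 2)) F - MvPowerSeries.rename (some : Fin 2 → Option (Fin 2)) (FT : MvPowerSeries (Fin 2) L)) := by ring
    rw [e1]
    exact Ideal.sub_mem _ h1 (Ideal.mem_sup_right htail)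
  exact MohWindowShadeAnchorOrder.not_le_span_pow_sup_of_cleaned hRS (MohWindowShadeFormalAnchor.spanFinrank_S L)
    (MohWindowShadeFormalAnchor.span_frame_eq_maximalIdeal L) MvPowerSeries.C (MohWindowShadeFormalAnchor.exists_sub_C_mem_maximalIdeal L)
    (j := (0 : Fin 2)) (i := 1) (by decide) (fun l => by fin_cases l <;> simp) hcleanT hoT hv hle'

omit hp [IsAlgClosed Ω] [DecidableEq Ω] [CharP Ω p] in
/-- Polynomials with coefficients in a subfield evaluate into the subfield. [folklore] -/
theorem eval_map_mem_of_mem {L : Type} [Field L] (ι : L →+* Ω) (P : Polynomial L) {x : Ω} (hx : x ∈ ι.fieldRange) :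
    (P.map ι).eval x ∈ ι.fieldRange := by
  rw [Polynomial.eval_eq_sum_range]
  refine Subfield.sum_mem _ fun n _ => Subfield.mul_mem _ ?_ (Subfield.pow_mem _ hx n)
  rw [Polynomial.coeff_map]; exact ⟨_, rfl⟩

omit [IsAlgClosed Ω] in
/-- **The degree law as subfield bookkeeping**: at a translated point inside the window where the shade does not drop, the coordinate of the
point lies in the coefficient subfield (a stall forces residue degree `1`; a linear monic has its root in the field). [folklore] -/
theorem mem_fieldRange_of_not_shadeDrops {L : Type} [Field L] [PerfectField L] (ι : L →+* Ω) {j i : Fin 2} (hij : i ≠ j)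
    (htwo : ∀ l, l = j ∨ l = i) (b : Fin 2 → Ω) (hbj : b j = 0) (S : Series (Fin 2) Ω) (F₀ : MvPowerSeries (Fin 2) L)
    (hF : S.F = MvPowerSeries.map ι F₀) {π : Polynomial L} (hirr : Irreducible π) (hm : π.Monic) (ht : (π.map ι).eval (b i) = 0)
    (hclean : IsClean p S.F) (hdiv : Divides S.r S.F) (heq : S.IsEquimultiplePoint p j b)
    (hwin : (p : ℕ∞) ≤ S.F.order ∧ S.F.order < (2 * p : ℕ)) (hwin' : (S.step p j b).F.order < (2 * p : ℕ))
    (hstall : ¬ S.ShadeDrops p j b) : b i ∈ ι.fieldRange := by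
  classical
  by_cases hbi : b i = 0
  · rw [hbi]; exact Subfield.zero_mem _
  obtain ⟨o, ho, ho2⟩ := S.exists_order_eq_of_lt hwin.2
  have hpo : p ≤ o := by have := hwin.1; rw [ho] at this; exact_mod_cast this
  have hlo : p < o := by
    rcases hpo.lt_or_eq with h | h
    · exact h
    · exact absurd heq (Series.not_isEquimultiplePoint_of_order_eq p hij htwo b hbj S hclean (by rw [ho, h]))
  obtain ⟨o', ho', ho'2⟩ := (S.step p j b).exists_order_eq_of_lt hwin'
  have hsep : π.Separable := PerfectField.separable_of_irreducible hirr
  obtain ⟨hlaw, hone⟩ := MohWindowShadeDegreeLaw.series_degree_mul_shade_step_le p hij htwo b hbj hbi S ho hlo ho2 hdiv heq ho' ho'2 ι F₀ hF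
    hirr hsep ht
  -- the shade is finite and does not drop: `m · a ≤ a`, `1 ≤ a`, so `m = 1`
  have hsh : S.shade = ((o - S.r.degree : ℕ) : ℕ∞) := S.shade_eq_of_order_eq ho
  have hsh' : (S.step p j b).shade = ((o' - (S.step p j b).r.degree : ℕ) : ℕ∞) := (S.step p j b).shade_eq_of_order_eq ho'
  unfold Series.ShadeDrops at hstall
  rw [hsh, hsh'] at hstall hlaw
  rw [hsh] at hone
  have h1 : o - S.r.degree ≤ o' - (S.step p j b).r.degree := by exact_mod_cast not_lt.mp hstall
  have h2 : π.natDegree * (o' - (S.step p j b).r.degree) ≤ o - S.r.degree := by exact_mod_cast hlaw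
  have h3 : 1 ≤ o - S.r.degree := by exact_mod_cast hone
  have hdeg : π.natDegree = 1 := by
    have hm1 : 1 ≤ π.natDegree := Polynomial.natDegree_pos_iff_degree_pos.mpr (Polynomial.degree_pos_of_irreducible hirr)
    have h4 : π.natDegree * (o - S.r.degree) ≤ 1 * (o - S.r.degree) := by
      calc π.natDegree * (o - S.r.degree) ≤ π.natDegree * (o' - (S.step p j b).r.degree) := Nat.mul_le_mul_left _ h1
        _ ≤ o - S.r.degree := h2
        _ = 1 * (o - S.r.degree) := (one_mul _).symm
    have h5 := Nat.le_of_mul_le_mul_right h4 (by omega)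
    omega
  -- a monic linear polynomial: its root is `−ι(π(0))`
  have hform := hm.eq_X_add_C hdeg
  have hroot : b i = ι (-(π.coeff 0)) := by
    have h := ht
    rw [hform, Polynomial.map_add, Polynomial.map_X, Polynomial.map_C, Polynomial.eval_add, Polynomial.eval_X, Polynomial.eval_C] at h
    rw [map_neg]; linear_combination h
  rw [hroot]; exact ⟨_, rfl⟩

/-! ## §3 The anchor predicate and one step along a hit thread -/

/-- **One step along a hit thread, anchors over the residue fields of the points, model in `Ω⟦y⟧`.** [OURS · L1 W4.6 rung (iii-2)] NOT a
statement of the manuscript. Hypothesis: at stage `k` the thread point carries an anchor over a perfect field `L ↪ Ω` (image `Λ`) whose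
model series read in `Ω` is `s.F`. Conclusion: the same at stage `k + 1` for a state `s′` and subfield `Λ′`, with: if the thread point is the
centre, `s′` is the Hauser–Wagner step of `s` at an equimultiple point `(c, b)` of the frame, the degree law «no shade drop ⇒ `b_{c′} ∈ Λ`»
(given cleanliness and `y^r ∣ F`) and «`b_{c′} ∈ Λ ⇒ Λ′ ⊆ Λ`»; otherwise `s′ = s`, `Λ′ = Λ`. [cite: StacksProject, Tag 0804] -/
theorem formalNRAnchor_succ (r : PermissibleRun p K) (hr : ∀ k, regimeMohWindowSurfaceInsep (p := p) (K := K) (r.A k) (r.E k))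
    (t : r.HitThread) (k : ℕ) (s : Series (Fin 2) Ω) (Λ : Subfield Ω) (hcl : IsClean p s.F)
    (hA : ∃ (L : Type) (_ : Field L) (_ : CharP L p) (_ : PerfectField L) (ι : L →+* Ω)
      (e : AdicCompletion (maximalIdeal ((r.A k).Z.presheaf.stalk (t.y k))) ((r.A k).Z.presheaf.stalk (t.y k)) ≃+* MvPowerSeries (Option (Fin 2)) L)
      (f₀ : (r.A k).Z.presheaf.stalk (t.y k)) (w : MvPowerSeries (Option (Fin 2)) L) (F : MvPowerSeries (Fin 2) L),
      ι.fieldRange = Λ ∧ stalkIdeal (r.E k).J (t.y k) = Ideal.span {f₀} ∧ IsUnit w ∧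
        e (algebraMap _ _ f₀) = w * (MvPowerSeries.X none ^ p + MvPowerSeries.rename (some : Fin 2 → Option (Fin 2)) F) ∧
        MvPowerSeries.map ι F = s.F) :
    ∃ (s' : Series (Fin 2) Ω) (Λ' : Subfield Ω) (c : Fin 2) (b : Fin 2 → Ω),
      ((r.D k : Set (r.A k).Z) = {t.y k} → s' = s.step p c b ∧ b c = 0 ∧ (c = 1 → ∀ l, b l = 0) ∧ s.IsEquimultiplePoint p c b ∧
        (∀ c', c' ≠ c → IsClean p s.F → Divides s.r s.F → ¬ s.ShadeDrops p c b → b c' ∈ Λ) ∧ (∀ c', c' ≠ c → b c' ∈ Λ → Λ' ≤ Λ)) ∧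
      ((r.D k : Set (r.A k).Z) ≠ {t.y k} → s' = s ∧ Λ' = Λ) ∧
      ∃ (L : Type) (_ : Field L) (_ : CharP L p) (_ : PerfectField L) (ι : L →+* Ω)
        (e : AdicCompletion (maximalIdeal ((r.A (k + 1)).Z.presheaf.stalk (t.y (k + 1)))) ((r.A (k + 1)).Z.presheaf.stalk (t.y (k + 1))) ≃+*
          MvPowerSeries (Option (Fin 2)) L)
        (f₀ : (r.A (k + 1)).Z.presheaf.stalk (t.y (k + 1))) (w : MvPowerSeries (Option (Fin 2)) L) (F : MvPowerSeries (Fin 2) L),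
        ι.fieldRange = Λ' ∧ stalkIdeal (r.E (k + 1)).J (t.y (k + 1)) = Ideal.span {f₀} ∧ IsUnit w ∧
          e (algebraMap _ _ f₀) = w * (MvPowerSeries.X none ^ p + MvPowerSeries.rename (some : Fin 2 → Option (Fin 2)) F) ∧
          MvPowerSeries.map ι F = s'.F := by
  classical
  obtain ⟨L, _instF, _instC, _instP, ι, e, f₀, w, F, hΛ, hJ, hw, hE, hsF⟩ := hA
  haveI : PerfectRing L p := PerfectField.toPerfectRing p
  -- data at stage `k`, moved to the point `π (y (k+1))`
  have hc := t.compat k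
  have hmem : (r.π k).base (t.y (k + 1)) ∈ (r.E k).sing := by rw [hc]; exact t.mem k
  obtain ⟨hR, h3, -, -, hb⟩ := MohWindowShadeAnchorWalk.regime_point (hr k) hmem
  obtain ⟨hR', h3', -, -, -⟩ := MohWindowShadeAnchorWalk.regime_point (hr (k + 1)) (t.mem (k + 1))
  haveI := hR
  have hA' : ∃ (e : AdicCompletion (maximalIdeal ((r.A k).Z.presheaf.stalk ((r.π k).base (t.y (k + 1)))))
        ((r.A k).Z.presheaf.stalk ((r.π k).base (t.y (k + 1)))) ≃+* MvPowerSeries (Option (Fin 2)) L)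
      (f₀ : (r.A k).Z.presheaf.stalk ((r.π k).base (t.y (k + 1)))),
      stalkIdeal (r.E k).J ((r.π k).base (t.y (k + 1))) = Ideal.span {f₀} ∧
        e (algebraMap _ _ f₀) = w * (MvPowerSeries.X none ^ p + MvPowerSeries.rename (some : Fin 2 → Option (Fin 2)) F) := by
    rw [hc]; exact ⟨e, f₀, hJ, hE⟩
  obtain ⟨e, f₀, hJ, hE⟩ := hA'
  have hwin := window_of_formalNRAnchor (hr k) hmem e hJ hw F hE
  obtain ⟨o, ho, -⟩ := MohWindowShadePS.Series.exists_order_eq_of_lt (⟨F, s.r⟩ : Series (Fin 2) L) hwin.2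
  have hpo : p ≤ o := by have := hwin.1; rw [show F = (⟨F, s.r⟩ : Series (Fin 2) L).F from rfl, ho] at this; exact_mod_cast this
  have hsing' : t.y (k + 1) ∈ ((r.E k).transform (r.π k) (r.D k)).sing := by
    have := t.mem (k + 1); rwa [r.E_succ k] at this
  by_cases hhit : (r.D k : Set (r.A k).Z) = {t.y k}
  · -- the thread point is blown up: the non-rational formal step
    have hD : (r.D k : Set (r.A k).Z) = {(r.π k).base (t.y (k + 1))} := by rw [hc]; exact hhit
    -- strictness `p < o` for the CLEANED anchor (brick 6 needs `ord F > p`)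
    have hlo : p < o := by
      have hcleanF : IsClean p F := fun d hd => by
        have h := hcl d hd
        rw [← hsF, MvPowerSeries.coeff_map] at h
        exact (map_eq_zero_iff ι ι.injective).mp h
      have h := order_gt_of_formalNRAnchor_clean (p := p) (hr k) hmem e hJ hw F hcleanF hE
      rw [show F = (⟨F, s.r⟩ : Series (Fin 2) L).F from rfl, ho] at h
      exact_mod_cast h
    obtain ⟨K₁, _i1, _i2, _i3, ι₁, c, b, E', f', w', F', π₀, c', hbc, hHW, hc'c, hirr, hm, hroot, hgenK₁, hequi, hJ', hw', hE', hstep⟩ :=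
      exists_formalNRAnchor_step ι (r.π k) (r.D k) (r.blowup k) hb hD hmem hsing' h3 hR' h3' e hJ hw F s.r ho hlo hE
    have hsΩ : (⟨MvPowerSeries.map ι F, s.r⟩ : Series (Fin 2) Ω) = s := by
      cases s with
      | mk sF sr => simp only at hsF ⊢; rw [hsF]
    rw [hsΩ] at hequi hstep
    refine ⟨s.step p c b, ι₁.fieldRange, c, b, fun _ => ⟨rfl, hbc, hHW, hequi, fun c'' hc'' hclean hdiv hstall => ?_, fun c'' hc'' hmemΛ => ?_⟩,
      fun h => absurd hhit h, K₁, _i1, _i2, _i3, ι₁, E', f', w', F', rfl, ?_, hw', hE', hstep⟩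
    · -- degree law
      have hcc : c'' = c' := by
        have key : ∀ a b c : Fin 2, a ≠ c → b ≠ c → a = b := by decide
        exact key c'' c' c hc'' hc'c
      subst hcc
      have htwo : ∀ l : Fin 2, l = c ∨ l = c'' := by
        intro l; by_cases h : l = c
        · exact Or.inl h
        · have key : ∀ a b c : Fin 2, a ≠ c → b ≠ c → a = b := by decide
          exact Or.inr (key l c'' c h hc'')
      -- window at stage `k + 1` through the new anchor
      have hwin' := window_of_formalNRAnchor (hr (k + 1)) (t.mem (k + 1)) E' (by rw [r.E_succ k]; exact hJ') hw' F' hE'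
      have hord' : (s.step p c b).F.order < (2 * p : ℕ) := by
        rw [← hstep, order_map_of_injective ι₁ ι₁.injective]; exact hwin'.2
      have hwinΩ : (p : ℕ∞) ≤ s.F.order ∧ s.F.order < (2 * p : ℕ) := by
        rw [← hsF, order_map_of_injective ι ι.injective]; exact hwin
      rw [← hΛ]
      exact mem_fieldRange_of_not_shadeDrops (p := p) ι hc'' htwo b hbc s F hsF.symm hirr hm hroot hclean hdiv hequi hwinΩ hord' hstall
    · -- `b_{c′} ∈ Λ ⇒ Λ′ ⊆ Λ`
      have hcc : c'' = c' := by
        have key : ∀ a b c : Fin 2, a ≠ c → b ≠ c → a = b := by decide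
        exact key c'' c' c hc'' hc'c
      subst hcc
      rintro x ⟨y, rfl⟩
      obtain ⟨P, hP⟩ := hgenK₁ y
      rw [hP, ← hΛ]
      rw [← hΛ] at hmemΛ
      exact eval_map_mem_of_mem ι P hmemΛ
    · rw [r.E_succ k]; exact hJ'
  · -- the thread point is not blown up: transport
    obtain ⟨ξ₀, -, -, hDξ₀⟩ := IsPermissibleCentre.exists_eq_singleton_of_isolatedSing (r.permissible k)
      ((regimeMohWindowSurfaceInsep_iff _ _).mp (hr k)).1.1
    have hoff : (r.π k).base (t.y (k + 1)) ∉ (r.D k : Set (r.A k).Z) := by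
      rw [hc, hDξ₀, Set.mem_singleton_iff]
      rintro rfl
      exact hhit hDξ₀
    obtain ⟨e', f', hJ', hE'⟩ := exists_formalNRAnchor_offCentre (E := r.E k) (r.π k) (r.blowup k) hoff e hJ _ hE
    refine ⟨s, Λ, 0, 0, fun h => absurd h hhit, fun _ => ⟨rfl, rfl⟩, L, _instF, _instC, _instP, ι, e', f', w, F, hΛ, ?_, hw, hE', hsF⟩
    rw [r.E_succ k]; exact hJ'


end Thread

end MohWindowShadeFormalNR

end CampaignW46

end Summit.ResolutionOfSingularities.ResolutionOfSingularities.Theorems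

end
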